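import Literature.NumberTheory.Transcendental.PadicLogPrincipalUnits
import Mathlib.NumberTheory.Padics.PadicNumbers
import HarnessLib

/-!
# Cell abc-stewartyu, crux `Y07Odd` (stmt-ABC-19658), line `gen3-slab-odd`: the SET-UP of the odd-`p`
# Gen-3 analytic frame — generators with a pivot, the twist, the `b`-eliminated linear forms, the exponent
# forms `L(λ)`, `E(λ)` and the two classes (twist class, `p`-adic slab)

`Summits/ABC/StewartYu/PadicG3Setup.lean` — cell `abc-stewartyu` (HOME `run/shared/lean/pub/abc-stewartyu/`,
design of record HOME/p2/SETUP3-SPEC.md, K-M3.1 ledgers HOME/p2/K-M3-1-ledger-p2.md and HOME/p1/K-M3-1-padic-ledger.md;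
seat p2-g4, F-odd lead).  Plain definitions and theorems; no named fact.  Symbols follow p1's K-M3.1 page §1.

This is the `n`-generator analogue of the M2 `TwistSetup` (`PadicTwistSetup.lean`) WITHOUT a separate eliminated
generator: the pivot `j₀` (a coefficient `b j₀ ≠ 0` of minimal `p`-adic order) lives among the `n` generators, as in
the frame spec `GenThreeFrameSpecOdd.FrameOdd`.  Contents:

* `G3Setup p`: `n` non-zero rationals `αⱼ`, integer coefficients `bⱼ`, the pivot `j₀`, roots of unity `ηⱼ ∈ ℚ_p`
  (`ηⱼ^{p−1} = 1`) twisting each `αⱼ` into a principal unit `ωⱼ = αⱼηⱼ` (Yu's device; for a `p`-adic unit `α` one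
  takes `η = ` the Teichmüller representative of `ᾱ⁻¹`);
* `ω`, `lg j = log_p ωⱼ` (`‖lg j‖ ≤ p⁻¹`, `exp (z • lg j) = ωⱼ^z`), the linear form `Λ = Σ bⱼ lg j`, the `p`-integral ratios
  `bⱼ/b_{j₀}`;
* the `b`-ELIMINATED INTEGER LINEAR FORMS `𝔛 λ k = b_{j₀} λ_k − b_k λ_{j₀}` (Nesterenko 2003, p. 68; `𝔛 λ j₀ = 0`), their
  linearity and behaviour under the descent re-indexing `λ = λ⁰ + c • μ`;
* the EXPONENT FORMS `Lsum λ = Σ λⱼ lg j` (`‖Lsum λ‖ ≤ p⁻¹`) and the `Λ`-free form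
  `E λ = Lsum λ − λ_{j₀} Λ / b_{j₀} = (b_{j₀})⁻¹ Σ_k (𝔛 λ k) lg k` (the exponent of Nesterenko's `f`, (4.16)–(4.17));
* the TWIST CLASS `cls λ = ∏ ηⱼ^{λⱼ}` (so `∏ ωⱼ^{λⱼ x} = (cls λ)^x · ∏ αⱼ^{λⱼ x}`: rational values up to a root of unity) and
  the `p`-ADIC SLAB property of a finite set of exponent vectors at depth `m`
  (`IsSlab m 𝔏 : ∀ λ λ′ ∈ 𝔏, ‖Lsum λ − Lsum λ′‖ ≤ p^{−(m+1)}` — Yu 1999's pigeonhole class, the `p`-adic η-slab of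
  K-M3.1), with the consequence that the class-difference exponents rescaled by `p^{−m}` have norm `≤ p⁻¹` when
  `‖Λ/b_{j₀}‖ ≤ p^{−(m+1)}` (so the landed depth-1 analytic layer applies in the variable `w = p^m ζ`).

WHAT THIS IS NOT: no Siegel step, no functions, no extrapolation; no crux moves.

## References
* Yu. V. Nesterenko, LNM 1819 (2003), §3.5 (p. 68: `∂ₖ`, `𝔛ₖ`), §4.2 (4.16)–(4.17). [Nesterenko2003]
* K. Yu, Acta Arith. 89 (1999), p. 340 and §10 (the class of the integral points); Compositio 74 (1990) §2 (the twist). [Yu1999] [Yu1990]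
-/

noncomputable section

open Finset NormedSpace
open Literature.NumberTheory.Transcendental

namespace Summit.ABC.StewartYu

/-- **The data of the odd-`p` Gen-3 frame.** [cite: Nesterenko2003, §3.5 (p. 68)] [cite: Yu1990, §2 (2.19)–(2.24)] -/
structure G3Setup (p : ℕ) [Fact p.Prime] where
  /-- the prime is odd (indeed `≥ 3`) -/
  hp3 : 3 ≤ p
  /-- the number of generators -/
  n : ℕ
  /-- the generators -/
  α : Fin n → ℚ
  /-- they are non-zero -/
  α_ne : ∀ j, α j ≠ 0
  /-- the integer coefficients of the linear form -/
  b : Fin n → ℤ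
  /-- the pivot -/
  j₀ : Fin n
  /-- its coefficient is non-zero -/
  bj₀_ne : b j₀ ≠ 0
  /-- and of MINIMAL `p`-adic order among the non-zero coefficients -/
  hbmin : ∀ j, b j ≠ 0 → padicValInt p (b j₀) ≤ padicValInt p (b j)
  /-- the twisting roots of unity -/
  η : Fin n → ℚ_[p]
  /-- `ηⱼ^{p−1} = 1` -/
  hη : ∀ j, η j ^ (p - 1) = 1
  /-- the twisted generators are principal units -/
  hprin : ∀ j, ‖(α j : ℚ_[p]) * η j - 1‖ ≤ (p : ℝ)⁻¹

namespace G3Setup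

variable {p : ℕ} [Fact p.Prime] (S : G3Setup p)

/-! ### Elementary facts about `p` -/

/-- `1 < p` (real). [folklore] -/
theorem one_lt_p (S : G3Setup p) : (1 : ℝ) < p := by
  have := S.hp3
  exact_mod_cast (show 1 < p by omega)

/-- `0 < p` (real). [folklore] -/
theorem p_pos (S : G3Setup p) : (0 : ℝ) < p := lt_trans zero_lt_one S.one_lt_p

/-- `‖(p : ℚ_p)‖ = p⁻¹`. [folklore] -/
theorem norm_p' : ‖(p : ℚ_[p])‖ = (p : ℝ)⁻¹ := Padic.norm_p

/-- `p⁻¹ < 1`. [folklore] -/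
theorem inv_p_lt_one (S : G3Setup p) : (p : ℝ)⁻¹ < 1 := inv_lt_one_of_one_lt₀ S.one_lt_p

/-! ### The twisted generators and their logarithms -/

/-- The twisted generator `ωⱼ = αⱼ ηⱼ`, a principal unit of `ℚ_p`. [cite: Yu1990, §2 (2.19)] -/
def ω (j : Fin S.n) : ℚ_[p] := (S.α j : ℚ_[p]) * S.η j

/-- `‖1 − ωⱼ‖ ≤ p⁻¹`. [cite: Yu1990, §2 (2.19)] -/
theorem norm_one_sub_ω_le (j : Fin S.n) : ‖1 - S.ω j‖ ≤ (p : ℝ)⁻¹ := by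
  rw [norm_sub_rev]; exact S.hprin j

/-- `ηⱼ ≠ 0`. [folklore] -/
theorem η_ne (j : Fin S.n) : S.η j ≠ 0 := by
  intro h
  have h1 := S.hη j
  have hp1 : p - 1 ≠ 0 := by have := S.hp3; omega
  rw [h, zero_pow hp1] at h1
  exact zero_ne_one h1

/-- `‖ηⱼ‖ = 1` (a root of unity). [folklore] -/
theorem norm_η (j : Fin S.n) : ‖S.η j‖ = 1 := by
  have hp1 : p - 1 ≠ 0 := by have := S.hp3; omega
  have h := congrArg norm (S.hη j)
  rw [norm_pow, norm_one] at h
  exact (pow_eq_one_iff_of_nonneg (norm_nonneg _) hp1).mp h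

/-- `‖ωⱼ‖ = 1`. [folklore] -/
theorem norm_ω (j : Fin S.n) : ‖S.ω j‖ = 1 :=
  IwasawaLog.norm_eq_one_of_norm_one_sub_lt ((S.norm_one_sub_ω_le j).trans_lt S.inv_p_lt_one)

/-- `ωⱼ ≠ 0`. [folklore] -/
theorem ω_ne (j : Fin S.n) : S.ω j ≠ 0 := norm_pos_iff.mp (by rw [S.norm_ω j]; exact one_pos)

/-- `lg j = log_p ωⱼ`. [cite: Yu1990, §1.1] -/
def lg (j : Fin S.n) : ℚ_[p] := PadicExp.plog (S.ω j)

/-- **`‖lg j‖ = ‖1 − ωⱼ‖ ≤ p⁻¹`.** [cite: Yu1990, §1.1] -/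
theorem norm_lg_le (j : Fin S.n) : ‖S.lg j‖ ≤ (p : ℝ)⁻¹ := by
  unfold lg
  rw [PadicExp.norm_plog S.hp3 (S.norm_one_sub_ω_le j)]
  exact S.norm_one_sub_ω_le j

/-- `exp (lg j) = ωⱼ`. [cite: Yu1990, §1.1] -/
theorem exp_lg (j : Fin S.n) : exp (S.lg j) = S.ω j :=
  PadicExp.exp_plog S.hp3 (S.norm_one_sub_ω_le j)

/-- `exp (z · lg j) = ωⱼ^z` for an integer `z`. [cite: Yu1990, §1.1] -/
theorem exp_intCast_mul_lg (j : Fin S.n) (z : ℤ) : exp ((z : ℚ_[p]) * S.lg j) = S.ω j ^ z :=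
  PadicExp.exp_intCast_mul_plog S.hp3 (S.norm_one_sub_ω_le j) z

/-! ### The coefficients -/

/-- `‖bⱼ‖_p ≤ 1`. [folklore] -/
theorem norm_b_le (j : Fin S.n) : ‖(S.b j : ℚ_[p])‖ ≤ 1 := Padic.norm_int_le_one _

/-- `0 < ‖b_{j₀}‖_p`. [folklore] -/
theorem norm_bj₀_pos : 0 < ‖(S.b S.j₀ : ℚ_[p])‖ := norm_pos_iff.mpr (by exact_mod_cast S.bj₀_ne)

/-- `b_{j₀} ≠ 0` in `ℚ_p`. [folklore] -/
theorem bj₀_ne' : (S.b S.j₀ : ℚ_[p]) ≠ 0 := by exact_mod_cast S.bj₀_ne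

/-- `‖z‖_p = p^{−ord_p z}` for a non-zero integer. [folklore] -/
theorem norm_intCast_eq' {z : ℤ} (hz : z ≠ 0) : ‖(z : ℚ_[p])‖ = (p : ℝ) ^ (-(padicValInt p z : ℤ)) := by
  have h := Padic.norm_eq_zpow_neg_valuation (p := p) (x := ((z : ℚ) : ℚ_[p])) (by exact_mod_cast hz)
  rw [Padic.valuation_ratCast, padicValRat.of_int] at h
  exact_mod_cast h

/-- **`‖bⱼ / b_{j₀}‖_p ≤ 1`** (the pivot has minimal order). [cite: Yu1990, Theorem 1 (ord_p bₙ ≤ ord_p bⱼ)] -/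
theorem norm_b_div_le (j : Fin S.n) : ‖(S.b j : ℚ_[p]) / (S.b S.j₀ : ℚ_[p])‖ ≤ 1 := by
  rw [norm_div]
  by_cases hj : S.b j = 0
  · rw [hj]; simp
  refine div_le_one_of_le₀ ?_ (norm_nonneg _)
  rw [norm_intCast_eq' hj, norm_intCast_eq' S.bj₀_ne]
  exact zpow_le_zpow_right₀ S.one_lt_p.le (neg_le_neg (Int.ofNat_le.mpr (S.hbmin j hj)))

/-! ### The linear form and the `b`-eliminated integer linear forms -/

/-- The (twisted) linear form `Λ = Σ bⱼ log_p ωⱼ`. [cite: Nesterenko2003, §2 (the form Λ)] -/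
def Λ : ℚ_[p] := ∑ j, (S.b j : ℚ_[p]) * S.lg j

/-- **The `b`-eliminated linear forms** `𝔛 λ k = b_{j₀} λ_k − b_k λ_{j₀}` (the eigenvalue of `∂ₖ` on `Y^λ`).
[cite: Nesterenko2003, §3.5 (p. 68)] -/
def 𝔛 (lam : Fin S.n → ℤ) (k : Fin S.n) : ℤ := S.b S.j₀ * lam k - S.b k * lam S.j₀

/-- `𝔛 λ j₀ = 0` (the pivot direction is absent). [cite: Nesterenko2003, §3.5 (p. 68)] -/
@[simp] theorem 𝔛_pivot (lam : Fin S.n → ℤ) : S.𝔛 lam S.j₀ = 0 := by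
  unfold 𝔛; ring

/-- `𝔛` is additive in `λ`. [folklore] -/
theorem 𝔛_add (lam lam' : Fin S.n → ℤ) (k : Fin S.n) : S.𝔛 (lam + lam') k = S.𝔛 lam k + S.𝔛 lam' k := by
  unfold 𝔛; simp only [Pi.add_apply]; ring

/-- `𝔛 (c • μ) = c · 𝔛 μ`. [folklore] -/
theorem 𝔛_smul (c : ℤ) (mu : Fin S.n → ℤ) (k : Fin S.n) : S.𝔛 (c • mu) k = c * S.𝔛 mu k := by
  unfold 𝔛; simp only [Pi.smul_apply, smul_eq_mul]; ring

/-- **Descent re-indexing**: `𝔛 (λ⁰ + c • μ) k = 𝔛 λ⁰ k + c · 𝔛 μ k` — the directional weights at level `s`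
(`c = 2ˢ`) are polynomials in `𝔛 μ k` with leading coefficient `cᵐ/m!` (`DirWeights.dirDeltaAff`).
[cite: Nesterenko2003, §3.5 (3.34), §4 (4.1)] -/
theorem 𝔛_add_smul (lam0 mu : Fin S.n → ℤ) (c : ℤ) (k : Fin S.n) :
    S.𝔛 (lam0 + c • mu) k = S.𝔛 lam0 k + c * S.𝔛 mu k := by
  rw [S.𝔛_add, S.𝔛_smul]

/-! ### The exponent forms `L(λ)` and `E(λ)` -/

/-- `Lsum λ = Σⱼ λⱼ log_p ωⱼ` (the exact exponent: `exp (x · Lsum λ) = ∏ ωⱼ^{λⱼ x}`).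
[cite: Nesterenko2003, §4 (4.7)] -/
def Lsum (lam : Fin S.n → ℤ) : ℚ_[p] := ∑ j, (lam j : ℚ_[p]) * S.lg j

/-- **`‖Lsum λ‖ ≤ p⁻¹`** (ultrametric; `‖λⱼ‖_p ≤ 1`). [folklore] -/
theorem norm_Lsum_le (lam : Fin S.n → ℤ) : ‖S.Lsum lam‖ ≤ (p : ℝ)⁻¹ := by
  unfold Lsum
  refine IsUltrametricDist.norm_sum_le_of_forall_le_of_nonneg (inv_nonneg.mpr S.p_pos.le) fun j _ => ?_
  rw [norm_mul]
  calc ‖(lam j : ℚ_[p])‖ * ‖S.lg j‖ ≤ 1 * (p : ℝ)⁻¹ :=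
        mul_le_mul (Padic.norm_int_le_one _) (S.norm_lg_le j) (norm_nonneg _) zero_le_one
    _ = (p : ℝ)⁻¹ := one_mul _

/-- `Lsum` is additive. [folklore] -/
theorem Lsum_add (lam lam' : Fin S.n → ℤ) : S.Lsum (lam + lam') = S.Lsum lam + S.Lsum lam' := by
  unfold Lsum
  rw [← sum_add_distrib]
  refine sum_congr rfl fun j _ => ?_
  simp only [Pi.add_apply, Int.cast_add]; ring

/-- `Lsum (c • μ) = c · Lsum μ`. [folklore] -/
theorem Lsum_smul (c : ℤ) (mu : Fin S.n → ℤ) : S.Lsum (c • mu) = (c : ℚ_[p]) * S.Lsum mu := by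
  unfold Lsum
  rw [mul_sum]
  refine sum_congr rfl fun j _ => ?_
  simp only [Pi.smul_apply, smul_eq_mul, Int.cast_mul]; ring

/-- `Lsum (λ − λ′) = Lsum λ − Lsum λ′`. [folklore] -/
theorem Lsum_sub (lam lam' : Fin S.n → ℤ) : S.Lsum (lam - lam') = S.Lsum lam - S.Lsum lam' := by
  unfold Lsum
  rw [← sum_sub_distrib]
  refine sum_congr rfl fun j _ => ?_
  simp only [Pi.sub_apply, Int.cast_sub]; ring

/-- **The `Λ`-free exponent** `E λ = Lsum λ − λ_{j₀} · Λ / b_{j₀}` (the exponent of Nesterenko's `f`).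
[cite: Nesterenko2003, §4.2 (4.16)–(4.17)] -/
def E (lam : Fin S.n → ℤ) : ℚ_[p] := S.Lsum lam - (lam S.j₀ : ℚ_[p]) * S.Λ / (S.b S.j₀ : ℚ_[p])

/-- **`E λ = (b_{j₀})⁻¹ · Σ_k (𝔛 λ k) · log_p ω_k`** — the exponent is a combination of the `b`-eliminated forms,
so `d/dζ` of `exp (ζ E λ)` is the direction-`k` bump with coefficient `lg k / b_{j₀}`.
[cite: Nesterenko2003, §4.2 (4.17), (4.20)] -/
theorem E_eq_sum_𝔛 (lam : Fin S.n → ℤ) :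
    S.E lam = (S.b S.j₀ : ℚ_[p])⁻¹ * ∑ k, (S.𝔛 lam k : ℚ_[p]) * S.lg k := by
  have hb : (S.b S.j₀ : ℚ_[p]) ≠ 0 := S.bj₀_ne'
  unfold E Lsum Λ 𝔛
  rw [div_eq_mul_inv]
  have h1 : ∑ k, ((S.b S.j₀ * lam k - S.b k * lam S.j₀ : ℤ) : ℚ_[p]) * S.lg k =
      (S.b S.j₀ : ℚ_[p]) * ∑ j, (lam j : ℚ_[p]) * S.lg j -
        (lam S.j₀ : ℚ_[p]) * ∑ j, (S.b j : ℚ_[p]) * S.lg j := by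
    rw [mul_sum, mul_sum, ← sum_sub_distrib]
    refine sum_congr rfl fun k _ => ?_
    push_cast; ring
  rw [h1, mul_sub, ← mul_assoc, inv_mul_cancel₀ hb, one_mul]
  congr 1
  field_simp

/-- `E` is additive. [folklore] -/
theorem E_sub (lam lam' : Fin S.n → ℤ) : S.E (lam - lam') = S.E lam - S.E lam' := by
  unfold E
  rw [S.Lsum_sub]
  simp only [Pi.sub_apply, Int.cast_sub]
  ring

/-- **`‖E λ − E λ′‖ ≤ max ‖Lsum(λ − λ′)‖ ‖Λ/b_{j₀}‖`** (ultrametric; `‖λ_{j₀} − λ′_{j₀}‖_p ≤ 1`). [folklore] -/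
theorem norm_E_sub_le (lam lam' : Fin S.n → ℤ) :
    ‖S.E lam - S.E lam'‖ ≤ max ‖S.Lsum (lam - lam')‖ ‖S.Λ / (S.b S.j₀ : ℚ_[p])‖ := by
  rw [← S.E_sub]
  unfold E
  rw [sub_eq_add_neg]
  refine (IsUltrametricDist.norm_add_le_max _ _).trans (max_le_max le_rfl ?_)
  rw [norm_neg, mul_div_assoc, norm_mul]
  calc ‖(((lam - lam') S.j₀ : ℤ) : ℚ_[p])‖ * ‖S.Λ / (S.b S.j₀ : ℚ_[p])‖
      ≤ 1 * ‖S.Λ / (S.b S.j₀ : ℚ_[p])‖ :=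
        mul_le_mul_of_nonneg_right (Padic.norm_int_le_one _) (norm_nonneg _)
    _ = _ := one_mul _

/-! ### The twist class and the values at integer points -/

/-- The twist class `cls λ = ∏ⱼ ηⱼ^{λⱼ} ∈ μ_{p−1}`. [cite: Yu1990, §2.3 (2.54)] -/
def cls (lam : Fin S.n → ℤ) : ℚ_[p] := ∏ j, S.η j ^ lam j

/-- `‖cls λ‖ = 1`. [folklore] -/
theorem norm_cls (lam : Fin S.n → ℤ) : ‖S.cls lam‖ = 1 := by
  unfold cls
  rw [norm_prod]
  exact prod_eq_one fun j _ => by rw [norm_zpow, S.norm_η, one_zpow]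

/-- **The value at an integer point**: `∏ⱼ ωⱼ^{λⱼ x} = (cls λ)^x · ∏ⱼ αⱼ^{λⱼ x}` — a root of unity times a
RATIONAL number (so, on a twist class, Siegel's lemma and Liouville work over `ℚ`). [cite: Yu1990, §2.3 (2.61)–(2.63)] -/
theorem prod_ω_zpow (lam : Fin S.n → ℤ) (x : ℤ) :
    ∏ j, S.ω j ^ (lam j * x) = S.cls lam ^ x * ((∏ j, S.α j ^ (lam j * x) : ℚ) : ℚ_[p]) := by
  unfold cls ω
  push_cast
  rw [← prod_zpow, ← prod_mul_distrib]
  refine prod_congr rfl fun j _ => ?_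
  rw [mul_zpow, ← zpow_mul, mul_comm (S.η j ^ _)]

/-- `exp (x · Lsum λ) = ∏ⱼ ωⱼ^{λⱼ x}` for an integer `x`. [cite: Nesterenko2003, §4 (4.7)] -/
theorem exp_intCast_mul_Lsum (lam : Fin S.n → ℤ) (x : ℤ) :
    exp ((x : ℚ_[p]) * S.Lsum lam) = ∏ j, S.ω j ^ (lam j * x) := by
  unfold Lsum
  rw [mul_sum]
  have hterm : ∀ j, (x : ℚ_[p]) * ((lam j : ℚ_[p]) * S.lg j) = (((lam j * x : ℤ)) : ℚ_[p]) * S.lg j := by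
    intro j; push_cast; ring
  simp_rw [hterm]
  rw [PadicExp.exp_sum_of_norm_le S.hp3]
  · exact prod_congr rfl fun j _ => S.exp_intCast_mul_lg j _
  · intro j _
    rw [norm_mul]
    calc ‖((lam j * x : ℤ) : ℚ_[p])‖ * ‖S.lg j‖ ≤ 1 * (p : ℝ)⁻¹ :=
          mul_le_mul (Padic.norm_int_le_one _) (S.norm_lg_le j) (norm_nonneg _) zero_le_one
      _ = (p : ℝ)⁻¹ := one_mul _

/-! ### The `p`-adic slab (Yu 1999's class of the integral points) -/

/-- **The slab property at depth `m`** of a finite set of exponent vectors: all `Lsum λ`, `λ ∈ 𝔏`, are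
congruent modulo `p^{m+1}` (`‖Lsum λ − Lsum λ′‖ ≤ p^{−(m+1)}`).  A pigeonhole over the `p^m` classes of
`p⁻¹ Lsum λ mod p^m` produces such an `𝔏` with `#𝔏 ≥ #𝔅/p^m` (Siegel file).
[cite: Yu1999, p. 340 and §10 (10.14)] -/
def IsSlab (m : ℕ) (𝔏 : Finset (Fin S.n → ℤ)) : Prop :=
  ∀ lam ∈ 𝔏, ∀ lam' ∈ 𝔏, ‖S.Lsum lam - S.Lsum lam'‖ ≤ (p : ℝ)⁻¹ ^ (m + 1)

/-- **The twist-class property** of a finite set of exponent vectors: `cls` is constant on it (pigeonhole over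
the `≤ p − 1` values, as in `PadicTwistSiegel.siegel_class`). [cite: Yu2013, (4.19)(iii)] -/
def IsTwistClass (𝔏 : Finset (Fin S.n → ℤ)) : Prop :=
  ∀ lam ∈ 𝔏, ∀ lam' ∈ 𝔏, S.cls lam = S.cls lam'

/-- Both class properties pass to subsets (the descent classes `𝔏_{s+1} ⊆ 𝔏_s`). [folklore] -/
theorem IsSlab.mono {m : ℕ} {𝔏 𝔏' : Finset (Fin S.n → ℤ)} (h : S.IsSlab m 𝔏) (h' : 𝔏' ⊆ 𝔏) :
    S.IsSlab m 𝔏' :=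
  fun lam hl lam' hl' => h lam (h' hl) lam' (h' hl')

/-- Both class properties pass to subsets. [folklore] -/
theorem IsTwistClass.mono {𝔏 𝔏' : Finset (Fin S.n → ℤ)} (h : S.IsTwistClass 𝔏) (h' : 𝔏' ⊆ 𝔏) :
    S.IsTwistClass 𝔏' :=
  fun lam hl lam' hl' => h lam (h' hl) lam' (h' hl')

/-- **The rescaled class-difference exponent** `e′ = p^{−m} · (E λ − E λ♭)` (the exponent of the class function
`G` in the variable `w = p^m ζ`). [cite: Yu1999, §10 (10.15)] -/
def eResc (m : ℕ) (lamb lam : Fin S.n → ℤ) : ℚ_[p] := ((p : ℚ_[p])⁻¹) ^ m * (S.E lam - S.E lamb)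

/-- **On a slab of depth `m`, if `‖Λ / b_{j₀}‖ ≤ p^{−(m+1)}` (the negated bound makes `Λ` far smaller), the
rescaled exponents have `‖e′‖ ≤ p⁻¹`** — so `w ↦ exp (w · e′)` is the depth-1 exponential of the landed M2 layer
(analytic of norm `1` on `‖w‖ < √p`), i.e. `ζ ↦ exp (ζ (E λ − E λ♭))` is analytic on `‖ζ‖ < p^m √p`: GAIN
`(m + ½) log p` PER ZERO at the integer nodes. [cite: Yu1999, p. 340, §10 (10.15)–(10.19)] -/
theorem norm_eResc_le {m : ℕ} {𝔏 : Finset (Fin S.n → ℤ)} (h𝔏 : S.IsSlab m 𝔏)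
    (hΛ : ‖S.Λ / (S.b S.j₀ : ℚ_[p])‖ ≤ (p : ℝ)⁻¹ ^ (m + 1))
    {lamb lam : Fin S.n → ℤ} (hb : lamb ∈ 𝔏) (hl : lam ∈ 𝔏) :
    ‖S.eResc m lamb lam‖ ≤ (p : ℝ)⁻¹ := by
  unfold eResc
  have hE : ‖S.E lam - S.E lamb‖ ≤ (p : ℝ)⁻¹ ^ (m + 1) :=
    (S.norm_E_sub_le lam lamb).trans (max_le (by rw [S.Lsum_sub]; exact h𝔏 lam hl lamb hb) hΛ)
  rw [norm_mul, norm_pow, norm_inv, norm_p', inv_inv]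
  have hp0 : (0 : ℝ) < p := S.p_pos
  calc (p : ℝ) ^ m * ‖S.E lam - S.E lamb‖ ≤ (p : ℝ) ^ m * ((p : ℝ)⁻¹ ^ (m + 1)) :=
        mul_le_mul_of_nonneg_left hE (by positivity)
    _ = (p : ℝ)⁻¹ := by
        rw [pow_succ, ← mul_assoc, ← mul_pow, mul_inv_cancel₀ hp0.ne', one_pow, one_mul]

/-- **The class function's value at an integer node**: `exp ((p^m x) · e′) = exp (x (E λ − E λ♭))` — the node
`x` is read at `w = p^m x`, of norm `≤ p^{−m}`. [cite: Yu1999, §10 (10.15)] -/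
theorem pm_mul_eResc (m : ℕ) (lamb lam : Fin S.n → ℤ) (x : ℚ_[p]) :
    ((p : ℚ_[p]) ^ m * x) * S.eResc m lamb lam = x * (S.E lam - S.E lamb) := by
  unfold eResc
  have hp : (p : ℚ_[p]) ≠ 0 := by exact_mod_cast (Fact.out : p.Prime).ne_zero
  rw [inv_pow]
  field_simp

/-- `‖p^m x‖ ≤ p^{−m}` for an integer node `x`. [folklore] -/
theorem norm_pm_mul_intCast_le (m : ℕ) (x : ℤ) : ‖(p : ℚ_[p]) ^ m * (x : ℚ_[p])‖ ≤ (p : ℝ)⁻¹ ^ m := by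
  rw [norm_mul, norm_pow, norm_p']
  exact mul_le_of_le_one_right (by positivity) (Padic.norm_int_le_one _)

end G3Setup

end Summit.ABC.StewartYu

end
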